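import Literature.Analysis.FluidPDE.BiotSavartCurlPair
import Literature.Analysis.FluidPDE.MollifiedField
import Literature.Analysis.FluidPDE.SpaceTimeCalculusC1
import Literature.Analysis.FluidPDE.AxisymmetricEuler
import HarnessLib

/-!
# The Lamb form of the convective term, and the kernel form of `curl (ρ ⋆ w)`

Analysis/FluidPDE support file (all results proved, no definitions) on the decomposition path of
`Literature.Analysis.FluidPDE.MajdaBertozzi2002_holderEulerUniqueness` (`ElgindiAprioriBlowupProofs.lean`),
brick B1′ (finite speed of propagation of the vorticity support of a `C¹` Euler solution, by the
mollified vorticity equation `∂ₜ curl (ρ ⋆ u) = −curl (ρ ⋆ (ω × u))`). Two ingredients of that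
equation:

* `convect_self_eq_cross_curl_add_gradient` — **the Lamb form** `(v·∇)v = (curl v) × v + ∇(½|v|²)`
  at every point of differentiability of `v : ℝ³ → ℝ³` (with `hasFDerivAt_half_norm_sq`,
  `D(½|v|²) = ⟪v, Dv ·⟫`); this is the identity by which the pressure and the Bernoulli term drop
  out of the curl of the momentum equation (Majda–Bertozzi, §2.1, (2.5));
* `curl_convolution_lsmul_eq_integral_cross` — **the kernel form**
  `curl (ρ ⋆ w)(x) = ∫ ∇ρ(t) × w(x − t) dt` for a `C¹_c` kernel `ρ` and a *continuous* field `w`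
  (the derivative falls on the kernel, Mathlib `HasCompactSupport.hasFDerivAt_convolution_left`,
  and `curlCLM (⟪∇ρ, ·⟫ ⊗ w) = ∇ρ × w`, `curlCLM_smulRight_innerSL`), with its integrability and
  linearity in `w` (`integrable_cross_gradient_comp_sub`, `curl_convolution_lsmul_add`,
  `curl_convolution_lsmul_neg`) — the form in which `curl (ρ ⋆ w)` is differentiated in time for
  the merely continuous fields `w = u(t)`, `∂ₜu(t)` of a `C¹` solution.

For `C¹` fields the companion identities `curl (ρ ⋆ v) = ρ ⋆ curl v`, `ρ ⋆ ∇q = ∇(ρ ⋆ q)`,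
`curl (ρ ⋆ ∇q) = 0` are in `ConvolutionCurlCalculus.lean`.

[folklore] (Majda–Bertozzi, §2.1; Evans, *PDE*, App. C.4, Thm. 7).
-/

noncomputable section

open MeasureTheory Set Filter Topology Function Metric InnerProductSpace ContinuousLinearMap
open scoped RealInnerProductSpace Convolution

namespace Literature.Analysis.FluidPDE

-- nested operator types
set_option maxSynthPendingDepth 3

/-! ### The Lamb form of the convective term -/

section Lamb

variable {v : EuclideanSpace ℝ (Fin 3) → EuclideanSpace ℝ (Fin 3)} {x : EuclideanSpace ℝ (Fin 3)}

/-- `D(½|v|²)(x) = ⟪v(x), Dv(x)·⟫`. [folklore] -/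
theorem hasFDerivAt_half_norm_sq (hv : DifferentiableAt ℝ v x) :
    HasFDerivAt (fun y => ‖v y‖ ^ 2 / 2) ((innerSL ℝ (v x)).comp (fderiv ℝ v x)) x := by
  have h := (hv.hasFDerivAt.norm_sq).mul_const (2⁻¹ : ℝ)
  have e : (fun y => ‖v y‖ ^ 2 * (2⁻¹ : ℝ)) = fun y => ‖v y‖ ^ 2 / 2 := by
    funext y; rw [div_eq_mul_inv]
  rw [e] at h
  refine h.congr_fderiv ?_
  ext w
  simp

/-- **Lamb form of the convective term**: `(v·∇)v = (curl v) × v + ∇(½|v|²)` at every point of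
differentiability (Majda–Bertozzi, §2.1, the identity behind (2.5)). [folklore] -/
theorem convect_self_eq_cross_curl_add_gradient (hv : DifferentiableAt ℝ v x) :
    convect v v x = cross (curl v x) (v x) + gradient (fun y => ‖v y‖ ^ 2 / 2) x := by
  set ℓ : EuclideanSpace ℝ (Fin 3) →L[ℝ] ℝ := (innerSL ℝ (v x)).comp (fderiv ℝ v x) with hℓ
  have hg : gradient (fun y => ‖v y‖ ^ 2 / 2) x =
      (InnerProductSpace.toDual ℝ (EuclideanSpace ℝ (Fin 3))).symm ℓ := by
    rw [gradient, (hasFDerivAt_half_norm_sq hv).fderiv]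
  have hgi : ∀ i : Fin 3, ((InnerProductSpace.toDual ℝ (EuclideanSpace ℝ (Fin 3))).symm ℓ) i =
      ⟪v x, fderiv ℝ v x (EuclideanSpace.single i 1)⟫ := fun i => by
    have h1 : ⟪(InnerProductSpace.toDual ℝ (EuclideanSpace ℝ (Fin 3))).symm ℓ,
        EuclideanSpace.single i (1 : ℝ)⟫ =
        ((InnerProductSpace.toDual ℝ (EuclideanSpace ℝ (Fin 3))).symm ℓ) i := by
      rw [EuclideanSpace.inner_single_right]; simp
    rw [← h1, InnerProductSpace.toDual_symm_apply, hℓ, ContinuousLinearMap.comp_apply,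
      innerSL_apply_apply]
  rw [hg, convect_apply, curl_eq_curlCLM]
  have hcoord : ∀ i, fderiv ℝ v x (v x) i = ∑ m, v x m * fderiv ℝ v x (EuclideanSpace.single m 1) i :=
    fun i => clm_apply_coord (fderiv ℝ v x) (v x) i
  ext i
  rw [PiLp.add_apply, hgi, hcoord]
  fin_cases i <;>
  simp [curlCLM_apply, Fin.sum_univ_three, cross, cross_apply, PiLp.inner_apply] <;> ring

end Lamb

/-! ### The kernel form of `curl (ρ ⋆ w)` and its linearity -/

section Kernel

variable {ρ : EuclideanSpace ℝ (Fin 3) → ℝ} {w w' : EuclideanSpace ℝ (Fin 3) → EuclideanSpace ℝ (Fin 3)}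

/-- Compact support of `∇ρ` for a compactly supported kernel (a private copy of the tree's
`hasCompactSupport_gradient`, `SmoothLocalEnergy.lean`, not imported here). [folklore] -/
private theorem hasCompactSupport_gradient' (hρc : HasCompactSupport ρ) :
    HasCompactSupport (gradient ρ) :=
  (hρc.fderiv (𝕜 := ℝ)).comp_left
    (g := (InnerProductSpace.toDual ℝ (EuclideanSpace ℝ (Fin 3))).symm) (map_zero _)

/-- **Kernel form**: `curl (ρ ⋆ w)(x) = ∫ ∇ρ(t) × w(x − t) dt` for a `C¹_c` kernel and a continuous
field (the derivative falls on the kernel, `D(ρ ⋆ w) = Dρ ⋆ w`, and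
`curlCLM (⟪∇ρ, ·⟫ ⊗ w) = ∇ρ × w`). [folklore] -/
theorem curl_convolution_lsmul_eq_integral_cross (hρ : ContDiff ℝ 1 ρ) (hρc : HasCompactSupport ρ)
    (hw : Continuous w) (x : EuclideanSpace ℝ (Fin 3)) :
    curl (ρ ⋆[lsmul ℝ ℝ, volume] w) x = ∫ t, cross (gradient ρ t) (w (x - t)) := by
  rw [curl_eq_curlCLM, (hρc.hasFDerivAt_convolution_left (lsmul ℝ ℝ) hρ
    hw.locallyIntegrable x).fderiv, convolution_def]
  have hpt : ∀ t, ((lsmul ℝ ℝ).precompL (EuclideanSpace ℝ (Fin 3)) (fderiv ℝ ρ t)) (w (x - t)) =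
      (innerSL ℝ (gradient ρ t)).smulRight (w (x - t)) := fun t => by
    ext a
    rw [fderiv_eq_innerSL_gradient ρ t]
    simp [precompL_apply, lsmul_apply]
  simp_rw [hpt]
  have hint : Integrable fun t => (innerSL ℝ (gradient ρ t)).smulRight (w (x - t)) := by
    refine Continuous.integrable_of_hasCompactSupport ?_ ?_
    · exact (ContinuousLinearMap.smulRightL ℝ (EuclideanSpace ℝ (Fin 3))
        (EuclideanSpace ℝ (Fin 3))).continuous₂.comp
        (((innerSL ℝ).continuous.comp (FluidPDE.continuous_gradient_of_contDiff hρ)).prodMk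
          (hw.comp (continuous_const.sub continuous_id)))
    · refine (hasCompactSupport_gradient' hρc).mono fun t ht => ?_
      contrapose! ht
      simp only [mem_support, not_not] at ht
      simp [ht]
  rw [← curlCLM.integral_comp_comm hint]
  refine integral_congr_ae (Eventually.of_forall fun t => ?_)
  exact curlCLM_smulRight_innerSL _ _

/-- The kernel integrand `t ↦ ∇ρ(t) × w(x − t)` is continuous with compact support, hence
integrable. [folklore] -/
theorem integrable_cross_gradient_comp_sub (hρ : ContDiff ℝ 1 ρ) (hρc : HasCompactSupport ρ)
    (hw : Continuous w) (x : EuclideanSpace ℝ (Fin 3)) :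
    Integrable fun t => cross (gradient ρ t) (w (x - t)) := by
  refine Continuous.integrable_of_hasCompactSupport ?_ ?_
  · exact (crossCLM.continuous₂).comp ((FluidPDE.continuous_gradient_of_contDiff hρ).prodMk
      (hw.comp (continuous_const.sub continuous_id)))
  · refine (hasCompactSupport_gradient' hρc).mono fun t ht => ?_
    contrapose! ht
    simp only [mem_support, not_not] at ht
    simp [← crossCLM_apply, ht]

/-- Linearity of the kernel form in the field: sums. [folklore] -/
theorem curl_convolution_lsmul_add (hρ : ContDiff ℝ 1 ρ) (hρc : HasCompactSupport ρ)
    (hw : Continuous w) (hw' : Continuous w') (x : EuclideanSpace ℝ (Fin 3)) :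
    curl (ρ ⋆[lsmul ℝ ℝ, volume] (w + w')) x =
      curl (ρ ⋆[lsmul ℝ ℝ, volume] w) x + curl (ρ ⋆[lsmul ℝ ℝ, volume] w') x := by
  rw [curl_convolution_lsmul_eq_integral_cross hρ hρc (hw.add hw') x,
    curl_convolution_lsmul_eq_integral_cross hρ hρc hw x,
    curl_convolution_lsmul_eq_integral_cross hρ hρc hw' x,
    ← integral_add (integrable_cross_gradient_comp_sub hρ hρc hw x)
      (integrable_cross_gradient_comp_sub hρ hρc hw' x)]
  refine integral_congr_ae (Eventually.of_forall fun t => ?_)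
  simp only [Pi.add_apply, ← crossCLM_apply, map_add]

/-- Linearity of the kernel form in the field: negation. [folklore] -/
theorem curl_convolution_lsmul_neg (hρ : ContDiff ℝ 1 ρ) (hρc : HasCompactSupport ρ)
    (hw : Continuous w) (x : EuclideanSpace ℝ (Fin 3)) :
    curl (ρ ⋆[lsmul ℝ ℝ, volume] (-w)) x = -curl (ρ ⋆[lsmul ℝ ℝ, volume] w) x := by
  rw [curl_convolution_lsmul_eq_integral_cross hρ hρc hw.neg x,
    curl_convolution_lsmul_eq_integral_cross hρ hρc hw x, ← integral_neg]
  refine integral_congr_ae (Eventually.of_forall fun t => ?_)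
  simp only [Pi.neg_apply, ← crossCLM_apply, map_neg]

end Kernel

end Literature.Analysis.FluidPDE
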